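import Mathlib.Analysis.InnerProductSpace.PiL2
import Literature.MathematicalPhysics.StatisticalMechanics.BarlowStacking
import Summits.AtomisticToContinuum.Crystallization.Theorems.SquareWellLayerCakeStackingFaultSparsityDefs

/-!
# The covering count (stub `stub_covering` of `StackingFaultSparsity`, line `Sketch`)

Deterministic combinatorial geometry for the crux `StackingFaultSparsity`
(item stmt-AtomisticToContinuum-14296, routes `SquareWellLayerCake` / `LaminarSixThreeThree`):
for ONE `d₀`-separated configuration `y : Fin N → E3`, the particles whose window is two-way
`(L, ε')`-matched to some Barlow stacking (`BarlowM L ε' y i`) but which admit no `(R, ε)`-hcp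
window (`¬ HcpM R ε y i`) number at most `C N / L`, `C = C(M₀, M, R, ε, d₀)`, given the statements
of `stub_windowToHcp` and `stub_subwindow` as hypotheses, the dilute-faults bound `Hdil` (at most
`M₀` cubic letters among the layers within `⌊L/(2h)⌋` of the base of a box-parameter matched window)
and the scale pinning `Hpin` (matched windows have box parameters `InBox a h`).

Proof: double counting of the pairs `(b, j)`, `b` bad, `dist (y j) (y b) < L/8`, for `L ≥ L₀`.
(i) `lower_count`: for bad `b` at least `(L/32)³` particles lie within `L/8` of `y b` — the
`(2n+1)³`, `n = ⌊L/32⌋`, stacking points with indices within `n` of the base lie within `3n` of it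
(`dist_barlowPos_le_of_abs_le`), the first matching clause attaches particles to them, injectively
as distinct stacking points are `≥ min a h > 2ε'` apart (`le_dist_barlowPos`).  (ii) For every `j`
at most `25 M₀ (2M+1) L²` bad `b` lie within `L/8` of `y j`: all lie within `L/4` of one of them,
`b₀`; each is `ε'`-close to the image of a point `barlowPos a h s k' i' j'` of the stacking matched
at `b₀` (second clause; injectively by `d₀`-separation), its own window is `(R, 2ε')`-matched there
(sub-window), so by window-to-hcp and `¬ HcpM` some cubic letter `m₀` has `|m₀ - k'| ≤ M`, whence
`|m₀ - k| ≤ ⌊L/(2h)⌋` (`mem_cubicNear_of_near`): `k'` takes `≤ M₀ (2M+1)` values (`Hdil`) and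
`i', j'` at most `4L + 1` each (`abs_index_sub_le`).  Hence `card · (L/32)³ ≤ N · 25 M₀ (2M+1) L²`;
below `L₀ := 4M + 4R + 40` the trivial bound `card ≤ N ≤ L₀ N / L` is used.
-/

noncomputable section
namespace Summit.AtomisticToContinuum.Crystallization.Theorems.SquareWellLayerCake.StackingFaultSparsity
open Literature.MathematicalPhysics.StatisticalMechanics
/-- Euclidean `3`-space. [folklore] -/
local notation "E3" => EuclideanSpace ℝ (Fin 3)

/-- A window sum of length `n` of a `±1` sequence has absolute value `≤ n`. -/
private theorem abs_haggWindow_le {s : ℤ → ℤ} (hs : IsHaggSeq s) (m : ℤ) (n : ℕ) :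
    |haggWindow s m n| ≤ n := by
  induction n with
  | zero => simp
  | succ n ih =>
    rw [haggWindow_succ]
    have h1 : |s (m + n)| ≤ 1 := by rcases hs (m + n) with h | h <;> simp [h]
    calc |haggWindow s m n + s (m + n)| ≤ |haggWindow s m n| + |s (m + n)| := abs_add_le _ _
      _ ≤ (n : ℤ) + 1 := by linarith
      _ = ((n + 1 : ℕ) : ℤ) := by push_cast; ring

/-- The layer labels of a Hägg word change by at most `|k' - k|` between layers `k` and `k'`. -/
private theorem abs_haggLabel_sub_le {s : ℤ → ℤ} (hs : IsHaggSeq s) (k k' : ℤ) :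
    |haggLabel s k' - haggLabel s k| ≤ |k' - k| := by
  rcases le_total k k' with hle | hle
  · obtain ⟨n, rfl⟩ : ∃ n : ℕ, k' = k + n := ⟨(k' - k).toNat, by omega⟩
    rw [haggLabel_add_natCast, add_sub_cancel_left, add_sub_cancel_left, Nat.abs_cast]
    exact abs_haggWindow_le hs k n
  · obtain ⟨n, rfl⟩ : ∃ n : ℕ, k = k' + n := ⟨(k - k').toNat, by omega⟩
    rw [haggLabel_add_natCast, abs_sub_comm, add_sub_cancel_left, abs_sub_comm, add_sub_cancel_left,
      Nat.abs_cast]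
    exact abs_haggWindow_le hs k' n

/-- Stacking points whose three indices differ by at most `D` are within `3 D` of each other
(for `0 ≤ a ≤ 1`, `0 ≤ h ≤ 1`). -/
private theorem dist_barlowPos_le_of_abs_le {a h D : ℝ} {s : ℤ → ℤ} (ha0 : 0 ≤ a) (ha1 : a ≤ 1)
    (hh0 : 0 ≤ h) (hh1 : h ≤ 1) (hs : IsHaggSeq s) {k i j k' i' j' : ℤ}
    (hk : |(k' : ℝ) - k| ≤ D) (hi : |(i' : ℝ) - i| ≤ D) (hj : |(j' : ℝ) - j| ≤ D) :
    dist (barlowPos a h s k' i' j') (barlowPos a h s k i j) ≤ 3 * D := by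
  have hD : 0 ≤ D := (abs_nonneg _).trans hk
  have hL : |(haggLabel s k' : ℝ) - haggLabel s k| ≤ D :=
    le_trans (by exact_mod_cast abs_haggLabel_sub_le hs k k') hk
  have h3 : (√3 : ℝ) ^ 2 = 3 := Real.sq_sqrt (by norm_num)
  obtain ⟨hk1, hk2⟩ := abs_le.mp hk
  obtain ⟨hi1, hi2⟩ := abs_le.mp hi
  obtain ⟨hj1, hj2⟩ := abs_le.mp hj
  obtain ⟨hL1, hL2⟩ := abs_le.mp hL
  have ha2 : a ^ 2 ≤ 1 := by nlinarith
  have hh2 : h ^ 2 ≤ 1 := by nlinarith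
  refine (pow_le_pow_iff_left₀ dist_nonneg (by positivity) two_ne_zero).1 ?_
  rw [dist_barlowPos_sq]
  set X := (i' : ℝ) - i + ((j' : ℝ) - j) / 2 + ((haggLabel s k' : ℝ) - haggLabel s k) / 2 with hXd
  set Y := (j' : ℝ) - j + ((haggLabel s k' : ℝ) - haggLabel s k) / 3 with hYd
  have hX : X ^ 2 ≤ (2 * D) ^ 2 := sq_le_sq' (by rw [hXd]; linarith) (by rw [hXd]; linarith)
  have hY : Y ^ 2 ≤ (4 * D / 3) ^ 2 := sq_le_sq' (by rw [hYd]; linarith) (by rw [hYd]; linarith)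
  have hT : ((k' : ℝ) - k) ^ 2 ≤ D ^ 2 := sq_le_sq' (by linarith) (by linarith)
  calc (a * X) ^ 2 + (a * √3 / 2 * Y) ^ 2 + (((k' : ℝ) - k) * h) ^ 2
      = a ^ 2 * X ^ 2 + a ^ 2 * (3 / 4) * Y ^ 2 + h ^ 2 * ((k' : ℝ) - k) ^ 2 := by
        rw [mul_pow, mul_pow, mul_pow, div_pow, mul_pow, h3]; ring
    _ ≤ 1 * (2 * D) ^ 2 + 1 * (3 / 4) * (4 * D / 3) ^ 2 + 1 * D ^ 2 := by gcongr
    _ ≤ (3 * D) ^ 2 := by nlinarith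

/-- **Lower count.** If the window of `b` is two-way `(L, ε')`-matched to a box-parameter Barlow
stacking, then at least `(L / 32) ^ 3` particles lie within `L / 8` of `y b`. -/
private theorem lower_count {N : ℕ} (y : Fin N → E3) (b : Fin N) {a h L ε' : ℝ} {s : ℤ → ℤ}
    {k i₀ j₀ : ℤ} {A : E3 →ₗᵢ[ℝ] E3} (hab : InBox a h) (hs : IsHaggSeq s)
    (hW : TwoWay (barlowStacking a h s) L ε' y b (barlowPos a h s k i₀ j₀) A)
    (hε' : ε' < 1 / 8) (hL : 8 ≤ L) :
    (L / 32) ^ 3 ≤ ((Finset.univ.filter fun j => dist (y j) (y b) < L / 8).card : ℝ) := by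
  classical
  obtain ⟨ha1, ha2, hh1, hh2⟩ := hab
  have ha0 : 0 < a := by linarith
  have hh0 : 0 < h := by nlinarith
  have hmin : 2 * ε' < min a h := lt_min (by linarith) (by nlinarith)
  set z := barlowPos a h s k i₀ j₀ with hz
  obtain ⟨n, hn⟩ : ∃ n : ℕ, n = ⌊L / 32⌋₊ := ⟨_, rfl⟩
  have hnL : (n : ℝ) ≤ L / 32 := hn ▸ Nat.floor_le (by positivity)
  have hLn : L / 32 < n + 1 := hn ▸ Nat.lt_floor_add_one _
  obtain ⟨I, hI⟩ : ∃ I : Finset ℤ, I = Finset.Icc (-(n : ℤ)) n := ⟨_, rfl⟩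
  have hIcard : I.card = 2 * n + 1 := by rw [hI, Int.card_Icc]; omega
  have hmemI : ∀ m ∈ I, |(m : ℝ)| ≤ n := fun m hm => by
    rw [hI, Finset.mem_Icc] at hm
    exact_mod_cast (abs_le.mpr ⟨hm.1, hm.2⟩ : |m| ≤ (n : ℤ))
  set P : ℤ × ℤ × ℤ → E3 := fun t => barlowPos a h s (k + t.1) (i₀ + t.2.1) (j₀ + t.2.2) with hP
  have hPdist : ∀ t ∈ I ×ˢ I ×ˢ I, dist (P t) z ≤ 3 * n := fun t ht => by
    simp only [Finset.mem_product] at ht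
    refine dist_barlowPos_le_of_abs_le ha0.le ha2 hh0.le (by nlinarith) hs ?_ ?_ ?_ <;>
      push_cast <;> simp only [add_sub_cancel_left]
    exacts [hmemI _ ht.1, hmemI _ ht.2.1, hmemI _ ht.2.2]
  have hPz : ∀ t ∈ I ×ˢ I ×ˢ I, ∃ j : Fin N, dist (y j) (y b + A (P t - z)) ≤ ε' := fun t ht =>
    hW.1 (P t) (barlowPos_mem _ _ _) ((hPdist t ht).trans (by linarith))
  set f : ℤ × ℤ × ℤ → Fin N := fun t =>
    if ht : ∃ j : Fin N, dist (y j) (y b + A (P t - z)) ≤ ε' then ht.choose else b with hf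
  have hfP : ∀ t ∈ I ×ˢ I ×ˢ I, dist (y (f t)) (y b + A (P t - z)) ≤ ε' := fun t ht => by
    simp only [hf, dif_pos (hPz t ht)]
    exact (hPz t ht).choose_spec
  have hmaps : Set.MapsTo f (I ×ˢ I ×ˢ I : Finset (ℤ × ℤ × ℤ))
      (Finset.univ.filter fun j => dist (y j) (y b) < L / 8 : Finset (Fin N)) := fun t ht => by
    have ht : t ∈ I ×ˢ I ×ˢ I := by exact_mod_cast ht
    refine Finset.mem_coe.2 (Finset.mem_filter.2 ⟨Finset.mem_univ _, ?_⟩)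
    have := dist_triangle (y (f t)) (y b + A (P t - z)) (y b)
    rw [dist_self_add_left, LinearIsometry.norm_map, ← dist_eq_norm] at this
    linarith [hfP t ht, hPdist t ht]
  have hinj : Set.InjOn f (I ×ˢ I ×ˢ I : Finset (ℤ × ℤ × ℤ)) := fun t ht t' ht' heq => by
    have ht : t ∈ I ×ˢ I ×ˢ I := by exact_mod_cast ht
    have ht' : t' ∈ I ×ˢ I ×ˢ I := by exact_mod_cast ht'
    have h1 := hfP t ht
    rw [heq] at h1
    have hd : dist (P t) (P t') < min a h := by
      have := dist_triangle_left (y b + A (P t - z)) (y b + A (P t' - z)) (y (f t'))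
      rw [dist_add_left, LinearIsometry.dist_map, dist_sub_right] at this
      linarith [hfP t' ht']
    have : (k + t.1, i₀ + t.2.1, j₀ + t.2.2) = (k + t'.1, i₀ + t'.2.1, j₀ + t'.2.2) := by
      by_contra hne
      exact absurd hd (not_lt.mpr (le_dist_barlowPos a h s ha0.le hh0.le hne))
    simp only [Prod.mk.injEq, add_right_inj] at this
    exact Prod.ext this.1 (Prod.ext this.2.1 this.2.2)
  have hcard := Finset.card_le_card_of_injOn f hmaps hinj
  rw [Finset.card_product, Finset.card_product, hIcard] at hcard
  calc (L / 32) ^ 3 ≤ ((2 * n + 1 : ℕ) : ℝ) ^ 3 := by gcongr; push_cast; linarith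
    _ = (((2 * n + 1) * ((2 * n + 1) * (2 * n + 1)) : ℕ) : ℝ) := by push_cast; ring
    _ ≤ _ := by exact_mod_cast hcard

/-- Index ranges of a stacking point within `D` of a base point (box parameters): the layers differ
by at most `D / h`, the in-layer indices by at most `2 D` and `3 D`. -/
private theorem abs_index_sub_le {a h D : ℝ} {s : ℤ → ℤ} (hab : InBox a h) (hs : IsHaggSeq s)
    {k i₀ j₀ k' i' j' : ℤ} (hD : dist (barlowPos a h s k' i' j') (barlowPos a h s k i₀ j₀) ≤ D) :
    |(k' : ℝ) - k| * h ≤ D ∧ |(j' : ℝ) - j₀| ≤ 2 * D ∧ |(i' : ℝ) - i₀| ≤ 3 * D := by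
  obtain ⟨ha1, ha2, hh1, hh2⟩ := hab
  have ha0 : 0 < a := by linarith
  have hh0 : (0.7332 : ℝ) ≤ h := by nlinarith
  have h3 : (1.7 : ℝ) ≤ √3 := (Real.le_sqrt (by norm_num) (by norm_num)).2 (by norm_num)
  have hc : ∀ l, |barlowPos a h s k' i' j' l - barlowPos a h s k i₀ j₀ l| ≤ D := fun l => by
    rw [← Real.dist_eq]; exact (PiLp.dist_apply_le _ _ l).trans hD
  have hΔ : |(haggLabel s k' : ℝ) - haggLabel s k| ≤ |(k' : ℝ) - k| := by
    exact_mod_cast abs_haggLabel_sub_le hs k k'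
  set Δ : ℝ := (haggLabel s k' : ℝ) - haggLabel s k with hΔdef
  have hT : |(k' : ℝ) - k| * h ≤ D := by
    rw [← abs_of_pos (by linarith : (0 : ℝ) < h), ← abs_mul, sub_mul]
    simpa only [barlowPos_apply_two] using hc 2
  have hY : a * √3 / 2 * |((j' : ℝ) - j₀) + Δ / 3| ≤ D := by
    have e : ((j' : ℝ) - j₀) + Δ / 3 =
        ((j' : ℝ) + (haggLabel s k' : ℝ) / 3) - ((j₀ : ℝ) + (haggLabel s k : ℝ) / 3) := by
      rw [hΔdef]; ring
    rw [e, ← abs_of_pos (by positivity : (0 : ℝ) < a * √3 / 2), ← abs_mul, mul_sub]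
    simpa only [barlowPos_apply_one] using hc 1
  have hX : a * |((i' : ℝ) - i₀) + ((j' : ℝ) - j₀) / 2 + Δ / 2| ≤ D := by
    have e : ((i' : ℝ) - i₀) + ((j' : ℝ) - j₀) / 2 + Δ / 2 = ((i' : ℝ) + (j' : ℝ) / 2 +
        (haggLabel s k' : ℝ) / 2) - ((i₀ : ℝ) + (j₀ : ℝ) / 2 + (haggLabel s k : ℝ) / 2) := by
      rw [hΔdef]; ring
    rw [e, ← abs_of_pos ha0, ← abs_mul, mul_sub]
    simpa only [barlowPos_apply_zero] using hc 0
  have hcoef : (0.79 : ℝ) ≤ a * √3 / 2 := by nlinarith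
  have hT' : |(k' : ℝ) - k| ≤ 1.37 * D := by nlinarith [abs_nonneg ((k' : ℝ) - k)]
  have hY' : |((j' : ℝ) - j₀) + Δ / 3| ≤ 1.27 * D := by
    nlinarith [abs_nonneg (((j' : ℝ) - j₀) + Δ / 3)]
  have hX' : |((i' : ℝ) - i₀) + ((j' : ℝ) - j₀) / 2 + Δ / 2| ≤ 1.07 * D := by
    nlinarith [abs_nonneg (((i' : ℝ) - i₀) + ((j' : ℝ) - j₀) / 2 + Δ / 2)]
  obtain ⟨hΔ1, hΔ2⟩ := abs_le.mp (hΔ.trans hT')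
  obtain ⟨hY1, hY2⟩ := abs_le.mp hY'
  obtain ⟨hX1, hX2⟩ := abs_le.mp hX'
  have hj : |(j' : ℝ) - j₀| ≤ 2 * D := abs_le.mpr ⟨by linarith, by linarith⟩
  obtain ⟨hj1, hj2⟩ := abs_le.mp hj
  exact ⟨hT, hj, abs_le.mpr ⟨by linarith, by linarith⟩⟩

/-- A layer `m₀` within `M` of a layer `k'` with `|k' - k| h ≤ D ≤ L / 4 + 1 / 8` is within
`⌊L / (2 h)⌋` of `k` (for `h ≤ 1` and `L ≥ 4 (M + 2)`). -/
private theorem mem_cubicNear_of_near {s : ℤ → ℤ} {k k' m₀ : ℤ} {M : ℕ} {h L D : ℝ} (hh0 : 0 < h)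
    (hh1 : h ≤ 1) (hLM : 4 * ((M : ℝ) + 2) ≤ L) (hDL : D ≤ L / 4 + 1 / 8)
    (hk : |(k' : ℝ) - k| * h ≤ D) (hm : |m₀ - k'| ≤ M) (hsm : s (m₀ + 1) = s m₀) :
    m₀ ∈ cubicNear s k ⌊L / (2 * h)⌋₊ := by
  refine (mem_cubicNear_iff _ _ _ _).2 ⟨?_, hsm⟩
  obtain ⟨n, hn⟩ : ∃ n : ℕ, n = ⌊L / (2 * h)⌋₊ := ⟨_, rfl⟩
  rw [← hn]
  have hnL : L / (2 * h) < n + 1 := hn ▸ Nat.lt_floor_add_one _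
  rw [div_lt_iff₀ (by positivity)] at hnL
  have hmk' : |(m₀ : ℝ) - k'| ≤ M := by exact_mod_cast hm
  have hMh : (M : ℝ) * h ≤ M := mul_le_of_le_one_right (Nat.cast_nonneg M) hh1
  have key : |(m₀ : ℝ) - k| ≤ n := by
    have h1 : |(m₀ : ℝ) - k| ≤ |(m₀ : ℝ) - k'| + |(k' : ℝ) - k| := abs_sub_le _ _ _
    have h2 : |(m₀ : ℝ) - k| * h ≤ M * h + D := by nlinarith [abs_nonneg ((k' : ℝ) - k)]
    by_contra hcon
    have h4 : (n : ℝ) * h < |(m₀ : ℝ) - k| * h := mul_lt_mul_of_pos_right (not_le.mp hcon) hh0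
    nlinarith
  obtain ⟨h5, h6⟩ := abs_le.mp (show |m₀ - k| ≤ (n : ℤ) by exact_mod_cast key)
  constructor <;> omega

/-- **Stub `stub_covering`** (deterministic count, one configuration).  For a `d₀`-separated
configuration `y`, if every box-parameter `(L, ε')`-Barlow-matched window carries at most `M₀` cubic
letters among the layers within `L/(2h)` of its base and every `(L, ε')`-Barlow-matched window has
box parameters, then the particles with an `(L, ε')`-Barlow window but no `(R, ε)`-hcp window
number at most `C N / L`, `C = C(M₀, M, R, ε, d₀)` (`2 (R + 1) ≤ M`, `2ε' ≤ ε`, `4ε' < d₀`); the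
statements of `stub_windowToHcp` / `stub_subwindow` are the first two hypotheses. -/
theorem stub_covering :
    (∀ {N : ℕ} (y : Fin N → E3) (i : Fin N) (a h R ε : ℝ) (s : ℤ → ℤ) (k₀ i₀ j₀ : ℤ) (M : ℕ)
      (A : E3 →ₗᵢ[ℝ] E3), 0 < a → 0 < h → 0 ≤ ε → R + ε < M * h → IsHaggSeq s →
      (∀ m : ℤ, |m - k₀| ≤ M → s (m + 1) = -s m) →
      TwoWay (barlowStacking a h s) R ε y i (barlowPos a h s k₀ i₀ j₀) A →
      ∃ z' ∈ hcpStacking a h, ∃ A' : E3 →ₗᵢ[ℝ] E3, TwoWay (hcpStacking a h) R ε y i z' A') →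
    (∀ {N : ℕ} (y : Fin N → E3) (i₀ i' : Fin N) (S : Set E3) (z p' : E3) (A : E3 →ₗᵢ[ℝ] E3)
      (L R ε' : ℝ), 0 ≤ ε' → 0 ≤ R → R + L / 2 + ε' ≤ L → TwoWay S L ε' y i₀ z A → p' ∈ S →
      dist (y i') (y i₀) ≤ L / 2 → dist (y i') (y i₀ + A (p' - z)) ≤ ε' →
      TwoWay S R (2 * ε') y i' p' A) →
    ∀ (M₀ M : ℕ) (R ε d₀ : ℝ), 0 < R → 0 < ε → ε < 1 / 4 → 0 < d₀ → 2 * (R + 1) ≤ (M : ℝ) →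
      ∃ C : ℝ, 0 ≤ C ∧ ∀ (L ε' : ℝ), 0 < L → 0 < ε' → 2 * ε' ≤ ε → 4 * ε' < d₀ →
        ∀ (N : ℕ) (y : Fin N → E3), (∀ i j : Fin N, i ≠ j → d₀ ≤ dist (y i) (y j)) →
        (∀ (i : Fin N) (a h : ℝ) (s : ℤ → ℤ) (k i₀ j₀ : ℤ) (A : E3 →ₗᵢ[ℝ] E3), InBox a h →
          IsHaggSeq s → TwoWay (barlowStacking a h s) L ε' y i (barlowPos a h s k i₀ j₀) A →
          (cubicNear s k ⌊L / (2 * h)⌋₊).card ≤ M₀) →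
        (∀ (i : Fin N) (a h : ℝ) (s : ℤ → ℤ) (z : E3) (A : E3 →ₗᵢ[ℝ] E3), 1 / 2 < a → a < 2 →
          1 / 2 < h → h < 2 → IsHaggSeq s → z ∈ barlowStacking a h s →
          TwoWay (barlowStacking a h s) L ε' y i z A → InBox a h) →
        (Nat.card {i : Fin N // BarlowM L ε' y i ∧ ¬ HcpM R ε y i} : ℝ) ≤ C * N / L := by
  intro H1 H2 M₀ M R ε d₀ hR hε hε4 hd₀ hM
  -- the threshold scale `L₀` and the constant `max L₀ K`
  set L₀ : ℝ := 4 * (M : ℝ) + 4 * R + 40 with hL₀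
  set K : ℝ := 2 ^ 15 * (25 * M₀ * (2 * M + 1)) with hK
  refine ⟨max L₀ K, le_max_of_le_left (by positivity), ?_⟩
  intro L ε' hL hε' hε'ε hε'd N y hsep Hdil Hpin
  classical
  set F : Finset (Fin N) := Finset.univ.filter fun i => BarlowM L ε' y i ∧ ¬ HcpM R ε y i with hF
  rw [Nat.subtype_card F (fun x => by simp [hF])]
  rcases lt_or_ge L L₀ with hLlt | hLge
  · -- small scales: the trivial bound `card F ≤ N ≤ L₀ N / L`
    have hFN : (F.card : ℝ) ≤ N := by
      exact_mod_cast (Finset.card_le_univ F).trans_eq (Fintype.card_fin N)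
    rw [le_div_iff₀ hL]
    calc (F.card : ℝ) * L ≤ N * L₀ := mul_le_mul hFN hLlt.le hL.le (Nat.cast_nonneg N)
      _ ≤ max L₀ K * N := by
          rw [mul_comm]; exact mul_le_mul_of_nonneg_right (le_max_left _ _) (by positivity)
  -- large scales: every bad particle has a box-parameter Barlow window based at a stacking point
  have hLM : 4 * ((M : ℝ) + 2) ≤ L := by linarith
  have hwin : ∀ b ∈ F, ¬ HcpM R ε y b ∧ ∃ (a h : ℝ) (s : ℤ → ℤ) (k i₀ j₀ : ℤ) (A : E3 →ₗᵢ[ℝ] E3),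
      InBox a h ∧ IsHaggSeq s ∧
      TwoWay (barlowStacking a h s) L ε' y b (barlowPos a h s k i₀ j₀) A := fun b hb => by
    rw [hF, Finset.mem_filter] at hb
    obtain ⟨⟨a, h, ha1, ha2, hh1, hh2, s, hs, z, hz, A, hW⟩, hnot⟩ := hb.2
    have hab : InBox a h := Hpin b a h s z A ha1 ha2 hh1 hh2 hs hz hW
    obtain ⟨k, i₀, j₀, rfl⟩ := hz
    exact ⟨hnot, a, h, s, k, i₀, j₀, A, hab, hs, hW⟩
  have hlow : ∀ b ∈ F,
      (L / 32) ^ 3 ≤ ((Finset.univ.filter fun j => dist (y j) (y b) < L / 8).card : ℝ) := by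
    intro b hb
    obtain ⟨-, a, h, s, k, i₀, j₀, A, hab, hs, hW⟩ := hwin b hb
    exact lower_count y b hab hs hW (by linarith) (by linarith)
  -- upper count: for every `j` at most `25 M₀ (2M+1) L²` bad particles lie within `L / 8` of `y j`
  have hup : ∀ j : Fin N,
      ((F.filter fun b => dist (y j) (y b) < L / 8).card : ℝ) ≤ 25 * M₀ * (2 * M + 1) * L ^ 2 := by
    intro j
    rcases (F.filter fun b => dist (y j) (y b) < L / 8).eq_empty_or_nonempty with h0 | ⟨b₀, hb₀⟩
    · rw [h0, Finset.card_empty, Nat.cast_zero]; positivity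
    obtain ⟨-, a, h, s, k, i₀, j₀, A, hab, hs, hW⟩ := hwin b₀ (Finset.mem_filter.1 hb₀).1
    set G := F.filter fun b => dist (y j) (y b) < L / 8 with hGdef
    have hG : ∀ i ∈ G, ¬ HcpM R ε y i ∧ dist (y i) (y b₀) ≤ L / 4 := fun i hi => by
      obtain ⟨hiF, hid⟩ := Finset.mem_filter.1 hi
      exact ⟨(hwin i hiF).1, by
        linarith [dist_triangle_left (y i) (y b₀) (y j), (Finset.mem_filter.1 hb₀).2]⟩
    obtain ⟨ha1, ha2, hh1, hh2⟩ := id hab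
    have ha0 : 0 < a := by linarith
    have hh0 : 0 < h := by nlinarith
    have hRM : R + 2 * ε' < M * h := by nlinarith
    set z := barlowPos a h s k i₀ j₀ with hz
    -- the admissible layers `U` and in-layer index ranges `[c - W, c + W]`
    set U : Finset ℤ := (cubicNear s k ⌊L / (2 * h)⌋₊).biUnion fun m => Finset.Icc (m - M) (m + M)
      with hU
    have hUcard : U.card ≤ M₀ * (2 * M + 1) :=
      calc U.card ≤ ∑ m ∈ cubicNear s k ⌊L / (2 * h)⌋₊, (Finset.Icc (m - M) (m + M)).card :=
            Finset.card_biUnion_le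
        _ = ∑ m ∈ cubicNear s k ⌊L / (2 * h)⌋₊, (2 * M + 1) :=
            Finset.sum_congr rfl fun m _ => by rw [Int.card_Icc]; omega
        _ ≤ M₀ * (2 * M + 1) := by
            rw [Finset.sum_const, smul_eq_mul]
            exact Nat.mul_le_mul_right _ (Hdil b₀ a h s k i₀ j₀ A hab hs hW)
    obtain ⟨W, hWdef⟩ : ∃ W : ℕ, W = ⌊2 * L⌋₊ := ⟨_, rfl⟩
    have hWL : 2 * L < W + 1 := hWdef ▸ Nat.lt_floor_add_one _
    have hWle : (W : ℝ) ≤ 2 * L := hWdef ▸ Nat.floor_le (by linarith)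
    have hIcc : ∀ c : ℤ, (Finset.Icc (c - W) (c + W)).card = 2 * W + 1 := fun c => by
      rw [Int.card_Icc]; omega
    set I : Finset (ℤ × ℤ × ℤ) :=
      U ×ˢ Finset.Icc (i₀ - W) (i₀ + W) ×ˢ Finset.Icc (j₀ - W) (j₀ + W) with hI
    -- particle ↦ matched stacking point (second matching clause), injective by separation
    set f : Fin N → E3 := fun i =>
      if hi : ∃ p ∈ barlowStacking a h s, dist (y i) (y b₀ + A (p - z)) ≤ ε' then hi.choose else 0
      with hf
    have hfS : ∀ i ∈ G, f i ∈ barlowStacking a h s ∧ dist (y i) (y b₀ + A (f i - z)) ≤ ε' := by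
      intro i hi
      have hex : ∃ p ∈ barlowStacking a h s, dist (y i) (y b₀ + A (p - z)) ≤ ε' :=
        hW.2 i ((hG i hi).2.trans (by linarith))
      simp only [hf, dif_pos hex]
      exact hex.choose_spec
    have hinj : Set.InjOn f G := fun i₁ h₁ i₂ h₂ heq => by
      by_contra hne
      have h1 := (hfS i₁ h₁).2
      rw [heq] at h1
      linarith [hsep i₁ i₂ hne, (dist_triangle_right (y i₁) (y i₂) (y b₀ + A (f i₂ - z))).trans
        (add_le_add h1 (hfS i₂ h₂).2)]
    have hmaps : Set.MapsTo f G (I.image fun t => barlowPos a h s t.1 t.2.1 t.2.2) := by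
      intro i hi
      have hi : i ∈ G := by exact_mod_cast hi
      obtain ⟨hpS, hpd⟩ := hfS i hi
      obtain ⟨hnot, hdist⟩ := hG i hi
      rw [Finset.coe_image]
      -- the sub-window at `i` based at `f i`
      have hW' : TwoWay (barlowStacking a h s) R (2 * ε') y i (f i) A :=
        H2 y b₀ i _ z _ A L R ε' hε'.le hR.le (by linarith) hW hpS (hdist.trans (by linarith)) hpd
      have hD : dist (f i) z ≤ L / 4 + ε' := by
        have := dist_triangle_left (y b₀ + A (f i - z)) (y b₀) (y i)
        rw [dist_self_add_left, LinearIsometry.norm_map, ← dist_eq_norm] at this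
        linarith
      generalize f i = p at hpS hW' hD
      obtain ⟨k', i', j', rfl⟩ := hpS
      refine ⟨(k', i', j'), ?_, rfl⟩
      -- no hcp window at `i`, so (window-to-hcp) the word does not alternate near `k'`
      obtain ⟨m₀, hm₀, hsm₀⟩ : ∃ m₀ : ℤ, |m₀ - k'| ≤ M ∧ s (m₀ + 1) = s m₀ := by
        by_contra hcon
        push Not at hcon
        have halt : ∀ m : ℤ, |m - k'| ≤ M → s (m + 1) = -s m := fun m hm => by
          have h1 := hcon m hm
          rcases hs (m + 1) with h2 | h2 <;> rcases hs m with h3 | h3 <;> omega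
        obtain ⟨z', hz', A', hA'⟩ :=
          H1 y i a h R (2 * ε') s k' i' j' M A ha0 hh0 (by linarith) hRM hs halt hW'
        exact hnot (HcpM.mono ⟨a, h, by linarith, by linarith, by linarith, by nlinarith, z', hz',
          A', hA'⟩ le_rfl hε'ε)
      obtain ⟨hk', hj', hi'⟩ := abs_index_sub_le hab hs hD
      have hm₀T : m₀ ∈ cubicNear s k ⌊L / (2 * h)⌋₊ :=
        mem_cubicNear_of_near hh0 (by nlinarith) hLM (by linarith) hk' hm₀ hsm₀
      have hWD : 3 * (L / 4 + ε') ≤ W := by linarith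
      have hi'' : |i' - i₀| ≤ (W : ℤ) := by exact_mod_cast hi'.trans hWD
      have hj'' : |j' - j₀| ≤ (W : ℤ) := by exact_mod_cast (hj'.trans (by linarith)).trans hWD
      obtain ⟨hm1, hm2⟩ := abs_le.mp hm₀
      obtain ⟨hi1, hi2⟩ := abs_le.mp hi''
      obtain ⟨hj1, hj2⟩ := abs_le.mp hj''
      simp only [hI, hU, Finset.mem_coe, Finset.mem_product, Finset.mem_biUnion, Finset.mem_Icc]
      exact ⟨⟨m₀, hm₀T, by omega, by omega⟩, ⟨by omega, by omega⟩, by omega, by omega⟩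
    calc (G.card : ℝ) ≤ (I.image fun t => barlowPos a h s t.1 t.2.1 t.2.2).card := by
          exact_mod_cast Finset.card_le_card_of_injOn f hmaps hinj
      _ ≤ I.card := by exact_mod_cast Finset.card_image_le
      _ ≤ ((M₀ * (2 * M + 1) * ((2 * W + 1) * (2 * W + 1)) : ℕ) : ℝ) := by
          rw [hI, Finset.card_product, Finset.card_product, hIcc, hIcc]
          exact_mod_cast Nat.mul_le_mul_right _ hUcard
      _ ≤ 25 * M₀ * (2 * M + 1) * L ^ 2 := by
          push_cast
          have h5 : 2 * (W : ℝ) + 1 ≤ 5 * L := by linarith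
          have h0 : (0 : ℝ) ≤ M₀ * (2 * M + 1) := by positivity
          calc (M₀ : ℝ) * (2 * M + 1) * ((2 * W + 1) * (2 * W + 1))
              ≤ M₀ * (2 * M + 1) * (5 * L * (5 * L)) :=
                mul_le_mul_of_nonneg_left (mul_le_mul h5 h5 (by positivity) (by linarith)) h0
            _ = 25 * M₀ * (2 * M + 1) * L ^ 2 := by ring
  -- double counting of the pairs `(b, j)`, `b ∈ F`, `dist (y j) (y b) < L / 8`
  have hsum : ∑ b ∈ F, ((Finset.univ.filter fun j => dist (y j) (y b) < L / 8).card : ℝ) =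
      ∑ j : Fin N, ((F.filter fun b => dist (y j) (y b) < L / 8).card : ℝ) := by
    simp only [Finset.card_filter, Nat.cast_sum, Nat.cast_ite, Nat.cast_one, Nat.cast_zero]
    exact Finset.sum_comm
  have h3 : (F.card : ℝ) * (L / 32) ^ 3 ≤ N * (25 * M₀ * (2 * M + 1) * L ^ 2) :=
    calc (F.card : ℝ) * (L / 32) ^ 3 = ∑ b ∈ F, (L / 32) ^ 3 := by
          rw [Finset.sum_const, nsmul_eq_mul]
      _ ≤ _ := Finset.sum_le_sum hlow
      _ = _ := hsum
      _ ≤ ∑ j : Fin N, (25 * M₀ * (2 * M + 1) * L ^ 2 : ℝ) := Finset.sum_le_sum fun j _ => hup j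
      _ = _ := by rw [Finset.sum_const, Finset.card_univ, Fintype.card_fin, nsmul_eq_mul]
  rw [le_div_iff₀ hL]
  calc (F.card : ℝ) * L = (F.card : ℝ) * (L / 32) ^ 3 * (2 ^ 15 / L ^ 2) := by field_simp; ring
    _ ≤ N * (25 * M₀ * (2 * M + 1) * L ^ 2) * (2 ^ 15 / L ^ 2) :=
        mul_le_mul_of_nonneg_right h3 (by positivity)
    _ = K * N := by rw [hK]; field_simp
    _ ≤ max L₀ K * N := mul_le_mul_of_nonneg_right (le_max_right _ _) (by positivity)

end Summit.AtomisticToContinuum.Crystallization.Theorems.SquareWellLayerCake.StackingFaultSparsity
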